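import Literature.MathematicalPhysics.QuantumLattice.HubbardCorrelatorCertificateAffine
import Literature.MathematicalPhysics.QuantumLattice.HubbardTorusLimitSpinCorrelationSign
import Literature.MathematicalPhysics.QuantumLattice.HubbardSpinReflectionSignRule
import Literature.MathematicalPhysics.QuantumLattice.HubbardNNNHoppingThermodynamicLimit
import Literature.MathematicalPhysics.QuantumLattice.HubbardEnergyDensityCertificateLimit
import Literature.MathematicalPhysics.QuantumLattice.HubbardLangerMattisTorus
import Summits.Ventures.CertifiedManyBodySolver.Statement

/-!
# M2 rows: half-filled square-lattice Hubbard model (`t = 1`, `t' = 0`) — thermodynamic-limit row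
# PREDICATES (rational slots) and the solver-free edges between rows

HONEST FRAMING (page 1): first certified bounds; not a superconductivity verdict; every number
certified or labelled float.

Rung M2 of the venture (speedrun cell `sr-mbsolver`, seat m2-4; memo
`run/shared/lean/speedrun/mbsolver/sr-mbsolver-m2-4/TL-STATEMENT.md`). Typed-statement policy D-8: every
row is a PREDICATE with explicit rational slots, instantiated by certificate files elsewhere; this file
contains NO number and NO certificate. DECISION (memo §0): every certified thermodynamic-limit (TL)
number bounds a TRANSLATION-INVARIANT infinite-volume functional directly — no torus extrapolation inside
a certified number (the only proved transfer `ThermodynamicLimit.energyDensity2D_le` costs `16|t|/L`).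
Contents (namespace `Summit.Ventures.CertifiedManyBodySolver.M2`): §1 the class `IsTLGS U ω` of
torus-limit half-filled ground states (= the hypothesis package on `ω` of
`InfVolFermionState.IsTorusLimitOf.re_expect_ge_of_window_certificate_d4_ineq`; nonempty by Lieb);
§2 rows (energy rows `M2Energy{Lower,Upper}Row`/`M2EnergyRow` live in the venture's `Statement.lean`;
edges here take their raw endpoints `lo ≤ e₀(U)`, `e₀(U) ≤ hi`; so do the CERTIFICATE-SHAPED one-sided
correlator rows `SquareCorrLowerRow`/`SquareCorrUpperRow` (energy hypothesis `e₀(U) ≤ u`),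
`M2DoccLowerRow`/`M2DoccUpperRow` and the docc word `doccAt0 2`, all imported from `Statement.lean`) —
`SpinNNLowerRow`/`SpinNNUpperRow`, the TABLE CELLS `CorrelatorRow`/`DoccRow`/`SpinNNRow` (two-sided over
ALL of TLGS, no energy hypothesis; `CorrelatorRow.of_lower_upper` discharges it with a certified `e₀(U) ≤ u`),
the finite-torus rows `TorusDoccRow`, `StagMagSqRow` (`m_s²(L) = ⟨𝓢_A⟩/L⁴ = S(π,π)/N`, full `𝐒·𝐒`)
and the TL ceiling row `StagMagSqTLCeilingRow` (`limsup_{L even} m_s²(L) ≤ hi`); §3 proved edges —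
torus family ⇒ energy upper, EVEN torus family ⇒ energy lower (passage to the limit), three energy rows ⇒
docc row (concavity), docc antitone in `U`,
Shen–Qiu–Tian sign clip, `m_s²(L) ≤ (1/4 + 1/L²)(1 − 2 d_L)`, `(3/2)(1 − 2 d_L)/L² ≤ m_s²(L)`, eventual
torus docc floor ⇒ TL ceiling `(1 − 2 dlo)/4`. Certificate classes are cited BY NAME, not restated.
NOT here: any TL lower bound on `m_s²` (Néel order, open); uniqueness; clustering; `T > 0`; numbers.
-/

noncomputable section

namespace Summit.Ventures.CertifiedManyBodySolver

open Literature.MathematicalPhysics.QuantumLattice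
open Matrix HubbardWave0 Literature.Probability.LatticeModels FermionSpinMoment ThermodynamicLimit Filter Topology
open scoped ComplexOrder BigOperators

namespace M2

/-! ## §1 The thermodynamic-limit objects -/

/-- **The class TLGS(U)**: `ω` is a weak-* limit (`InfVolFermionState.IsTorusLimitOf`) of the
translation-averaged expectations of normalised `L²`-particle ground states of the even `L × L` tori;
every TL correlator row quantifies over ALL of it (no uniqueness claimed). [cite: BratteliRobinsonII1997, §6.2.4] -/
def IsTLGS (U : ℝ) (ω : InfVolFermionState 2) : Prop :=
  ∃ (Ls : ℕ → ℕ) (ψ : ∀ L, Fock (Orb (FermionTorus 2 L))),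
    Tendsto Ls atTop atTop ∧ (∀ j, Even (Ls j)) ∧
    (∀ j, IsGroundState (hamiltonian (fermionTorusGraph 2 (Ls j)) 1 U) (Ls j ^ 2) (ψ (Ls j))) ∧
    (∀ j, star (ψ (Ls j)) ⬝ᵥ ψ (Ls j) = 1) ∧ ω.IsTorusLimitOf ψ Ls

/-- TLGS(U) is nonempty for `U > 0` (Lieb's unique half-filled ground state on every even torus,
Banach–Alaoglu along a subsequence). [cite: LiebPRL1989, Theorem 2] -/
theorem IsTLGS.nonempty {U : ℝ} (hU : 0 < U) : ∃ ω : InfVolFermionState 2, IsTLGS U ω := by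
  obtain ⟨Ls, ψ, ω, hLs, hev, hψ, h1, hω⟩ :=
    LiebHalfFilled.exists_isTorusLimitOf_groundState (t := (1 : ℝ)) one_ne_zero hU
  exact ⟨ω, Ls, ψ, hLs, hev, hψ, h1, hω⟩

/-- Every `ω ∈ TLGS(U)` is translation invariant (the averaging). [cite: BratteliRobinsonII1997, §6.2.4] -/
theorem IsTLGS.isTranslationInvariant {U : ℝ} {ω : InfVolFermionState 2} (h : IsTLGS U ω) :
    ω.IsTranslationInvariant := by
  obtain ⟨Ls, ψ, -, -, -, -, hω⟩ := h
  exact hω.isTranslationInvariant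

/-- Every `ω ∈ TLGS(U)` has energy density `ω(h₀) = e₀(U)` (`U ≥ 0`), hence minimises it among
translation-invariant states (`isLeast_hubbardEnergyDensity_energyDensity2D`). [cite: BratteliRobinsonII1997, §6.2.4] -/
theorem IsTLGS.hubbardEnergyDensity_eq {U : ℝ} (hU : 0 ≤ U) {ω : InfVolFermionState 2}
    (h : IsTLGS U ω) : ω.hubbardEnergyDensity 1 U = energyDensity2D 1 U 1 := by
  obtain ⟨Ls, ψ, hLs, hev, hψ, h1, hω⟩ := h
  exact hω.hubbardEnergyDensity_eq_energyDensity2D_of_isGroundState hLs hev 1 hU hψ h1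

/-! ## §2 Row predicates (the left-hand sides of the M2 table; slots `lo hi : ℚ`) -/

/-- **TL correlator TABLE CELL** for `X ∈ 𝔄_Λ`: `lo ≤ Re ω(X) ≤ hi` for EVERY `ω ∈ TLGS(U)`, no energy
hypothesis (from the one-sided rows by `CorrelatorRow.of_lower_upper`). [cite: BratteliRobinsonII1997, §6.2.4] -/
def CorrelatorRow (U : ℝ) (Λ : Finset (Site 2)) (X : FermionOp Λ) (lo hi : ℚ) : Prop :=
  ∀ ω : InfVolFermionState 2, IsTLGS U ω →
    ((lo : ℚ) : ℝ) ≤ (ω.expect Λ X).re ∧ (ω.expect Λ X).re ≤ ((hi : ℚ) : ℝ)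

/-- The cell's certificate-shaped row `SquareCorrLowerRow` (Statement.lean §S2; binders verbatim from the
substrate nodes `sdp_corr_TL_hubSQ_*`) read over TLGS(U) (currying of the `∃`-package). [cite: WangEtAl2024, §III] -/
theorem squareCorrLowerRow_iff {U : ℝ} {u q : ℚ} {Λ : Finset (Site 2)} {X : FermionOp Λ} :
    SquareCorrLowerRow U u q Λ X ↔ ∀ ω : InfVolFermionState 2, IsTLGS U ω →
      energyDensity2D 1 U 1 ≤ ((u : ℚ) : ℝ) → ((q : ℚ) : ℝ) ≤ (ω.expect Λ X).re :=
  ⟨fun h ω ⟨Ls, ψ, hLs, hev, hψ, hn, hω⟩ hu => h ω Ls ψ hLs hev hψ hn hω hu,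
    fun h ω Ls ψ hLs hev hψ hn hω hu => h ω ⟨Ls, ψ, hLs, hev, hψ, hn, hω⟩ hu⟩

/-- Upper twin of `squareCorrLowerRow_iff` (`SquareCorrUpperRow`, Statement.lean §S2). [cite: WangEtAl2024, §III] -/
theorem squareCorrUpperRow_iff {U : ℝ} {u q : ℚ} {Λ : Finset (Site 2)} {X : FermionOp Λ} :
    SquareCorrUpperRow U u q Λ X ↔ ∀ ω : InfVolFermionState 2, IsTLGS U ω →
      energyDensity2D 1 U 1 ≤ ((u : ℚ) : ℝ) → (ω.expect Λ X).re ≤ ((q : ℚ) : ℝ) :=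
  ⟨fun h ω ⟨Ls, ψ, hLs, hev, hψ, hn, hω⟩ hu => h ω Ls ψ hLs hev hψ hn hω hu,
    fun h ω Ls ψ hLs hev hψ hn hω hu => h ω ⟨Ls, ψ, hLs, hev, hψ, hn, hω⟩ hu⟩

/-- **Reconciliation edge**: a certified energy UPPER `e₀(U) ≤ u` (`M2EnergyUpperRow U u` /
`(M2EnergyRow U lo u).2` of Statement.lean, unfolded) discharges the energy hypothesis of the two certificate
rows issued for `u` ⇒ the unconditional table cell over ALL of TLGS(U). [cite: WangEtAl2024, §III] -/
theorem CorrelatorRow.of_lower_upper {U : ℝ} {u lo hi : ℚ} {Λ : Finset (Site 2)} {X : FermionOp Λ}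
    (hE : energyDensity2D 1 U 1 ≤ ((u : ℚ) : ℝ)) (hl : SquareCorrLowerRow U u lo Λ X)
    (hu : SquareCorrUpperRow U u hi Λ X) : CorrelatorRow U Λ X lo hi := fun ω hω =>
  ⟨squareCorrLowerRow_iff.1 hl ω hω hE, squareCorrUpperRow_iff.1 hu ω hω hE⟩

/-- Conversely a table cell gives the certificate-shaped rows for every `u`. [cite: WangEtAl2024, §III] -/
theorem CorrelatorRow.lower_upper {U : ℝ} {lo hi : ℚ} {Λ : Finset (Site 2)} {X : FermionOp Λ}
    (h : CorrelatorRow U Λ X lo hi) (u : ℚ) : SquareCorrLowerRow U u lo Λ X ∧ SquareCorrUpperRow U u hi Λ X :=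
  ⟨squareCorrLowerRow_iff.2 fun ω hω _ => (h ω hω).1, squareCorrUpperRow_iff.2 fun ω hω _ => (h ω hω).2⟩

/-- **TL double-occupancy row** `docc : lo ≤ Re ω(n_{0↑}n_{0↓}) ≤ hi` on TLGS(U) (word `doccAt0 2` of
Statement.lean; its one-sided certificate rows are `M2DoccLowerRow`/`M2DoccUpperRow` there). [cite: KomaTasaki1994, §1] -/
def DoccRow (U : ℝ) (lo hi : ℚ) : Prop := CorrelatorRow U ({0} : Finset (Site 2)) (doccAt0 2) lo hi

/-- Docc instance of `CorrelatorRow.of_lower_upper`: `M2DoccLowerRow U u lo`, `M2DoccUpperRow U u hi`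
(Statement.lean) and a certified `e₀(U) ≤ u` give the table cell `DoccRow U lo hi`. [cite: WangEtAl2024, §III] -/
theorem DoccRow.of_lower_upper {U : ℝ} {u lo hi : ℚ} (hE : energyDensity2D 1 U 1 ≤ ((u : ℚ) : ℝ))
    (hl : M2DoccLowerRow U u lo) (hu : M2DoccUpperRow U u hi) : DoccRow U lo hi :=
  CorrelatorRow.of_lower_upper hE hl hu

/-- The nearest-neighbour spin observable `𝐒_0·𝐒_{e₁} ∈ 𝔄_{{0,e₁}}` (the `spin_nn` objective, per bond).
[cite: ShenQiuTian1994, Theorem and eqs. (7)–(9)] -/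
def spinNNObs : FermionOp ({0, unitVec 0} : Finset (Site 2)) :=
  spinDotAt 0 (Finset.mem_insert_self _ _) (unitVec 0) (Finset.mem_insert_of_mem (Finset.mem_singleton_self _))

/-- **TL nearest-neighbour spin row** `spin_nn : lo ≤ Re ω(𝐒_0·𝐒_{e₁}) ≤ hi` on TLGS(U).
[cite: ShenQiuTian1994, Theorem and eqs. (7)–(9)] -/
def SpinNNRow (U : ℝ) (lo hi : ℚ) : Prop := CorrelatorRow U ({0, unitVec 0} : Finset (Site 2)) spinNNObs lo hi

/-- Certificate-shaped nearest-neighbour spin rows. [cite: ShenQiuTian1994, Theorem and eqs. (7)–(9)] -/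
def SpinNNLowerRow (U : ℝ) (u q : ℚ) : Prop := SquareCorrLowerRow U u q ({0, unitVec 0} : Finset (Site 2)) spinNNObs

/-- Upper twin of `SpinNNLowerRow`. [cite: ShenQiuTian1994, Theorem and eqs. (7)–(9)] -/
def SpinNNUpperRow (U : ℝ) (u q : ℚ) : Prop := SquareCorrUpperRow U u q ({0, unitVec 0} : Finset (Site 2)) spinNNObs

/-- The even sublattice `A = {x : (-1)^{x₁+x₂} = 1}` of the `L × L` torus. [cite: LiebPRL1989, Theorem 2] -/
def evenSublattice (L : ℕ) [NeZero L] : Finset (FermionTorus 2 L) :=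
  Finset.univ.filter fun z : FermionTorus 2 L => torusStagger z = 1

/-- The double-occupancy DENSITY `d_L(ψ) = Re ⟨ψ, D̂ ψ⟩ / L²`, `D̂ = Σ_x n_{x↑}n_{x↓}`, of a torus vector.
[cite: KomaTasaki1994, §1] -/
def doccDensity (L : ℕ) [NeZero L] (ψ : Fock (Orb (FermionTorus 2 L))) : ℝ :=
  (expect (∑ x : FermionTorus 2 L, numberOp x 0 * numberOp x 1) ψ).re / (L : ℝ) ^ 2

/-- `m_s²(L; ψ) = Re ⟨ψ, 𝓢_A ψ⟩ / L⁴`, `𝓢_A = Σ_{x,y} ε_x ε_y 𝐒_x·𝐒_y` (`= S(π,π)/N`, FULL `𝐒·𝐒`;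
singlet: `S(π,π) = 3 S^{zz}(π,π)`). [cite: LiebPRL1989, Theorem 2] -/
def stagMagSq (L : ℕ) [NeZero L] (ψ : Fock (Orb (FermionTorus 2 L))) : ℝ :=
  (expect (stagSpinStructure (evenSublattice L)) ψ).re / (L : ℝ) ^ 4

/-- **Finite-torus docc row** (`N = L²`, every normalised ground state): `lo ≤ d_L ≤ hi`; a row AT `L`.
[cite: KomaTasaki1994, §1] -/
def TorusDoccRow (L : ℕ) [NeZero L] (U : ℝ) (lo hi : ℚ) : Prop :=
  ∀ ψ : Fock (Orb (FermionTorus 2 L)), IsGroundState (hamiltonian (fermionTorusGraph 2 L) 1 U) (L ^ 2) ψ →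
    star ψ ⬝ᵥ ψ = 1 → ((lo : ℚ) : ℝ) ≤ doccDensity L ψ ∧ doccDensity L ψ ≤ ((hi : ℚ) : ℝ)

/-- **Finite-torus `m_s²` row** (`N = L²`, every normalised ground state): `lo ≤ m_s²(L) ≤ hi`; compared
with QMC at the same `L`, never a TL row. [cite: LiebPRL1989, Theorem 2] -/
def StagMagSqRow (L : ℕ) [NeZero L] (U : ℝ) (lo hi : ℚ) : Prop :=
  ∀ ψ : Fock (Orb (FermionTorus 2 L)), IsGroundState (hamiltonian (fermionTorusGraph 2 L) 1 U) (L ^ 2) ψ →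
    star ψ ⬝ᵥ ψ = 1 → ((lo : ℚ) : ℝ) ≤ stagMagSq L ψ ∧ stagMagSq L ψ ≤ ((hi : ℚ) : ℝ)

/-- **TL staggered-magnetisation CEILING row** `ms2_TL_hi : limsup_{L even → ∞} m_s²(L) ≤ hi` ("for every
`ε > 0`, eventually every normalised half-filled ground state has `m_s²(L) ≤ hi + ε`"). ONE-SIDED by design
(a TL lower bound = Néel order, open). [cite: KomaTasaki1994, Theorem 2.5] -/
def StagMagSqTLCeilingRow (U : ℝ) (hi : ℚ) : Prop :=
  ∀ ε : ℝ, 0 < ε → ∃ L₀ : ℕ, ∀ (L : ℕ) [NeZero L], L₀ ≤ L → Even L →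
    ∀ ψ : Fock (Orb (FermionTorus 2 L)), IsGroundState (hamiltonian (fermionTorusGraph 2 L) 1 U) (L ^ 2) ψ →
      star ψ ⬝ᵥ ψ = 1 → stagMagSq L ψ ≤ ((hi : ℚ) : ℝ) + ε

/-! ## §3 Solver-free edges between rows -/

/-- **Torus family ⇒ TL energy upper**: if every `(a k) × (a k)` torus (`a` even, `k ≥ 1`) has
`(a k)²`-particle ground energy `≤ (a k)² · u`, then `e₀(U) ≤ u` (the limit exists; subsequence `L = a k`,
`energyDensityTT'_le_of_frequently_le`, no `16|t|/L`). [cite: Ruelle1969, §3.3] -/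
theorem energyDensity2D_le_of_torusFamily {U : ℝ} (hU : 0 ≤ U) {a : ℕ} (ha : 1 ≤ a) (hae : Even a) {u : ℝ}
    (h : ∀ k : ℕ, 1 ≤ k →
      groundEnergyAt (fermionRectTorusGraph (a * k) (a * k)) 1 U ((a * k) ^ 2) ≤ ((a * k : ℕ) : ℝ) ^ 2 * u) :
    energyDensity2D 1 U 1 ≤ u := by
  rw [← energyDensityTT'_zero]
  refine energyDensityTT'_le_of_frequently_le 1 0 hU (n := 1) zero_le_one one_lt_two (μ := 0) ?_
  rw [Filter.frequently_atTop]
  intro b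
  refine ⟨a * (b + 1), le_trans (Nat.le_succ b) (Nat.le_mul_of_pos_left (b + 1) ha), ?_⟩
  have hk := h (b + 1) (by omega)
  have hN : rectN 1 (a * (b + 1)) = (a * (b + 1)) ^ 2 :=
    HartreeFock.rectN_one_of_even (hae.mul_right _)
  have hpos : (0 : ℝ) < ((a * (b + 1) : ℕ) : ℝ) ^ 2 := by positivity
  rw [hubbardRectTorusTT'_zero, hN, zero_mul, add_zero, div_le_iff₀ hpos]
  simpa [groundEnergyAt, mul_comm] using hk

/-- **Even torus family ⇒ TL energy lower** (the Lean column of a torus-pull-back row, e.g. a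
translation-invariant moment certificate read through its soundness memo, op-layer Theorem 0 at `d = 2`,
`n = 1`; or a KKT-assisted window certificate valid on every large even torus): if every EVEN `L × L` torus
with `L ≥ L₀` has `L²`-particle ground energy `≥ L² · lo`, then `lo ≤ e₀(U)` (the limit exists; even
subsequence, `energyDensityTT'_ge_of_frequently_ge`; no finite-size transfer term). [cite: Ruelle1969, §3.3] -/
theorem energyDensity2D_ge_of_evenTorusFamily {U : ℝ} (hU : 0 ≤ U) {L₀ : ℕ} {lo : ℝ}
    (h : ∀ L : ℕ, L₀ ≤ L → Even L →
      ((L : ℕ) : ℝ) ^ 2 * lo ≤ groundEnergyAt (fermionTorusGraph 2 L) 1 U (L ^ 2)) :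
    lo ≤ energyDensity2D 1 U 1 := by
  rw [← energyDensityTT'_zero]
  refine energyDensityTT'_ge_of_frequently_ge 1 0 hU (n := 1) zero_le_one one_lt_two (μ := 0) ?_
  rw [Filter.frequently_atTop]
  intro b
  refine ⟨2 * (b + L₀ + 1), by omega, ?_⟩
  have hk := h (2 * (b + L₀ + 1)) (by omega) (even_two_mul _)
  rw [groundEnergyAt_fermionTorusGraph_two] at hk
  have hN : rectN 1 (2 * (b + L₀ + 1)) = (2 * (b + L₀ + 1)) ^ 2 :=
    HartreeFock.rectN_one_of_even (even_two_mul _)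
  have hpos : (0 : ℝ) < ((2 * (b + L₀ + 1) : ℕ) : ℝ) ^ 2 := by positivity
  rw [hubbardRectTorusTT'_zero, hN, zero_mul, add_zero, le_div_iff₀ hpos]
  simpa [groundEnergyAt, mul_comm] using hk

/-- **Three TL energy endpoints ⇒ a TL docc row** (concavity: `e₀(U') − e₀(U) ≤ (U' − U)·Re ω(n↑n↓)` on
TLGS(U), all `U' ≥ 0`): rational `0 ≤ U' < U < U''`, certified `lo' ≤ e₀(U')`, `e₀(U) ≤ hi`, `lo'' ≤ e₀(U'')`
(endpoints of the cell's energy rows, Statement.lean) give `d(U) ∈ [(lo''−hi)/(U''−U), (hi−lo')/(U−U')]`.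
[cite: KomaTasaki1994, §1] -/
theorem DoccRow.of_energyRows {U' U U'' : ℚ} (hU' : 0 ≤ U') (h1 : U' < U) (h2 : U < U'')
    {lo' hi lo'' : ℚ} (hlo' : ((lo' : ℚ) : ℝ) ≤ energyDensity2D 1 U' 1)
    (hhi : energyDensity2D 1 U 1 ≤ ((hi : ℚ) : ℝ)) (hlo'' : ((lo'' : ℚ) : ℝ) ≤ energyDensity2D 1 U'' 1) :
    DoccRow U ((lo'' - hi) / (U'' - U)) ((hi - lo') / (U - U')) := by
  intro ω hω
  obtain ⟨Ls, ψ, hLs, hev, hψ, hn, hω⟩ := hω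
  have hU'r : (0 : ℝ) ≤ (U' : ℝ) := by exact_mod_cast hU'
  have h1r : ((U' : ℚ) : ℝ) < U := by exact_mod_cast h1
  have h2r : ((U : ℚ) : ℝ) < U'' := by exact_mod_cast h2
  have hU : (0 : ℝ) ≤ (U : ℝ) := hU'r.trans h1r.le
  have hU'' : (0 : ℝ) ≤ (U'' : ℝ) := hU.trans h2r.le
  have hA := hω.energyDensity2D_sub_le_mul_re_expect_docc_halfFilled hLs hev 1 hU hU'' hψ hn
  have hB := hω.energyDensity2D_sub_le_mul_re_expect_docc_halfFilled hLs hev 1 hU hU'r hψ hn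
  unfold doccAt0
  push_cast
  constructor
  · rw [div_le_iff₀ (sub_pos.2 h2r)]
    linarith
  · rw [le_div_iff₀ (sub_pos.2 h1r)]
    linarith

/-- `d(U)` is non-increasing in `U` on TLGS (`0 ≤ U₁ < U₂`): a docc FLOOR transports down in `U`, a
CEILING up. [cite: KomaTasaki1994, §1] -/
theorem docc_anti {U₁ U₂ : ℝ} (hU₁ : 0 ≤ U₁) (hU : U₁ < U₂) {ω₁ ω₂ : InfVolFermionState 2}
    (h₁ : IsTLGS U₁ ω₁) (h₂ : IsTLGS U₂ ω₂) :
    (ω₂.expect ({0} : Finset (Site 2)) (doccAt0 2)).re ≤ (ω₁.expect ({0} : Finset (Site 2)) (doccAt0 2)).re := by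
  obtain ⟨Ls₁, ψ₁, hLs₁, hev₁, hψ₁, hn₁, hω₁⟩ := h₁
  obtain ⟨Ls₂, ψ₂, hLs₂, hev₂, hψ₂, hn₂, hω₂⟩ := h₂
  exact hω₁.re_expect_docc_anti_halfFilled hω₂ hLs₁ hLs₂ hev₁ hev₂ 1 hU₁ hU hψ₁ hn₁ hψ₂ hn₂

/-- **Shen–Qiu–Tian on TLGS**: `Re ω(𝐒_0·𝐒_{e₁}) ≤ 0`, `U > 0`, no certificate. [cite: ShenQiuTian1994, Theorem and eqs. (7)–(9)] -/
theorem spinNN_nonpos {U : ℝ} (hU : 0 < U) {ω : InfVolFermionState 2} (hω : IsTLGS U ω) :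
    (ω.expect ({0, unitVec 0} : Finset (Site 2)) spinNNObs).re ≤ 0 := by
  obtain ⟨Ls, ψ, hLs, hev, hψ, -, hω⟩ := hω
  exact hω.re_expect_spinDotAt_nonpos_of_adj one_ne_zero hU hLs hev hψ _ _ (zdGraph_adj_zero_unitVec 0)

/-- **Sign clip** of a `spin_nn` cell: `hi ↦ min hi 0`. [cite: ShenQiuTian1994, Theorem and eqs. (7)–(9)] -/
theorem SpinNNRow.clip {U : ℝ} (hU : 0 < U) {lo hi : ℚ} (h : SpinNNRow U lo hi) :
    SpinNNRow U lo (min hi 0) := by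
  intro ω hω
  obtain ⟨hlo, hhi⟩ := h ω hω
  refine ⟨hlo, ?_⟩
  push_cast
  exact le_min hhi (spinNN_nonpos hU hω)

/-- `⟨Σ_x m_x⟩ = L² − 2 ⟨D̂⟩` in an `L²`-particle unit vector of the `L × L` torus (`m_x` the local
moment). [cite: HirschPRB1985, Table II] -/
theorem re_expect_sum_localMoment {L : ℕ} [NeZero L] {ψ : Fock (Orb (FermionTorus 2 L))}
    (hN : IsNParticle (L ^ 2) ψ) (hψ1 : star ψ ⬝ᵥ ψ = 1) :
    (expect (∑ x : FermionTorus 2 L, localMoment x) ψ).re =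
      (L : ℝ) ^ 2 - 2 * (expect (∑ x : FermionTorus 2 L, numberOp x 0 * numberOp x 1) ψ).re := by
  unfold Literature.MathematicalPhysics.QuantumLattice.expect
  rw [sum_localMoment_eq, sub_mulVec, smul_mulVec, totalNumber_mulVec_of_isNParticle hN, dotProduct_sub,
    dotProduct_smul, dotProduct_smul, hψ1, Complex.sub_re, smul_eq_mul, mul_one, Complex.natCast_re, smul_eq_mul,
    Complex.mul_re, Complex.re_ofNat, Complex.im_ofNat, zero_mul, sub_zero]
  push_cast
  ring

/-- **Moment-depletion ceiling** (any `L²`-particle unit vector, `L` even): `m_s²(L) ≤ (1/4 + 1/L²)(1 − 2 d_L)`.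
[cite: Tasaki2020, App. A.3] -/
theorem stagMagSq_le {L : ℕ} [NeZero L] (hL : Even L) {ψ : Fock (Orb (FermionTorus 2 L))}
    (hN : IsNParticle (L ^ 2) ψ) (hψ1 : star ψ ⬝ᵥ ψ = 1) :
    stagMagSq L ψ ≤ (1 / 4 + 1 / (L : ℝ) ^ 2) * (1 - 2 * doccDensity L ψ) := by
  obtain ⟨-, -, h2, -⟩ := LiebHalfFilled.hubbardTorus_lieb_hypotheses (L := L) hL
  have hAc := LiebHalfFilled.compl_card_eq_card_of_two_mul h2
  have hcard : Fintype.card (FermionTorus 2 L) = L ^ 2 := LangerMattis.card_fermionTorus_eq (d := 2) (L := L)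
  have h := re_expect_stagSpinStructure_le (evenSublattice L) le_rfl (le_of_eq hAc) hN hψ1
  have hk : ((evenSublattice L).card : ℝ) = (L : ℝ) ^ 2 / 2 := by
    have h2' : (2 : ℝ) * ((evenSublattice L).card : ℝ) = (((L ^ 2 : ℕ)) : ℝ) := by
      rw [← hcard]; exact_mod_cast h2
    push_cast at h2'
    linarith
  have hL0 : (0 : ℝ) < (L : ℝ) := by exact_mod_cast Nat.pos_of_ne_zero (NeZero.ne L)
  have hL0' : (L : ℝ) ≠ 0 := hL0.ne'
  rw [hk] at h
  push_cast at h
  unfold stagMagSq doccDensity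
  unfold Literature.MathematicalPhysics.QuantumLattice.expect
  rw [div_le_iff₀ (by positivity)]
  have key : (1 / 4 + 1 / (L : ℝ) ^ 2) *
        (1 - 2 * ((star ψ ⬝ᵥ ((∑ x : FermionTorus 2 L, numberOp x 0 * numberOp x 1) *ᵥ ψ)).re / (L : ℝ) ^ 2)) *
        (L : ℝ) ^ 4 =
      ((L : ℝ) ^ 2 / 2 + 2) / 2 *
        ((L : ℝ) ^ 2 - 2 * (star ψ ⬝ᵥ ((∑ x : FermionTorus 2 L, numberOp x 0 * numberOp x 1) *ᵥ ψ)).re) := by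
    field_simp
    ring
  rw [key]
  exact h

/-- **Néel-sum floor** (ground states, `U > 0`, `L` even): `(3/2)(1 − 2 d_L)/L² ≤ m_s²(L)` — `O(1/L²)`,
informative at `L = 4` only. [cite: ShenQiuTian1994, Theorem and eqs. (7)–(9)] -/
theorem stagMagSq_ge {U : ℝ} (hU : 0 < U) {L : ℕ} [NeZero L] (hL : Even L)
    {ψ : Fock (Orb (FermionTorus 2 L))} (hψ : IsGroundState (hamiltonian (fermionTorusGraph 2 L) 1 U) (L ^ 2) ψ)
    (hψ1 : star ψ ⬝ᵥ ψ = 1) :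
    3 / 2 * (1 - 2 * doccDensity L ψ) / (L : ℝ) ^ 2 ≤ stagMagSq L ψ := by
  have h := hubbardTorus_three_halves_localMoment_le_stagSpinStructure_of_isGroundState (L := L) hL
    one_ne_zero hU hψ
  rw [re_expect_sum_localMoment hψ.1 hψ1] at h
  have hL0 : (0 : ℝ) < (L : ℝ) := by exact_mod_cast Nat.pos_of_ne_zero (NeZero.ne L)
  have hL0' : (L : ℝ) ≠ 0 := hL0.ne'
  unfold stagMagSq doccDensity evenSublattice
  rw [le_div_iff₀ (by positivity : (0 : ℝ) < (L : ℝ) ^ 4)]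
  have key : 3 / 2 * (1 - 2 * ((expect (∑ x : FermionTorus 2 L, numberOp x 0 * numberOp x 1) ψ).re / (L : ℝ) ^ 2)) /
        (L : ℝ) ^ 2 * (L : ℝ) ^ 4 =
      3 / 2 * ((L : ℝ) ^ 2 - 2 * (expect (∑ x : FermionTorus 2 L, numberOp x 0 * numberOp x 1) ψ).re) := by
    field_simp
  rw [key]
  exact h

/-- **A docc row AT `L` is an `m_s²` bracket AT `L`** (even `L`, `U > 0`). [cite: Tasaki2020, App. A.3] -/
theorem StagMagSqRow.of_torusDoccRow {U : ℝ} (hU : 0 < U) {L : ℕ} [NeZero L] (hL : Even L)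
    {dlo dhi : ℚ} (h : TorusDoccRow L U dlo dhi) :
    StagMagSqRow L U (3 / 2 * (1 - 2 * dhi) / (L : ℚ) ^ 2) ((1 / 4 + 1 / (L : ℚ) ^ 2) * (1 - 2 * dlo)) := by
  intro ψ hψ hψ1
  obtain ⟨hdlo, hdhi⟩ := h ψ hψ hψ1
  push_cast
  constructor
  · refine le_trans ?_ (stagMagSq_ge hU hL hψ hψ1)
    gcongr
  · refine (stagMagSq_le hL hψ.1 hψ1).trans ?_
    gcongr

/-- **Eventual torus docc floor ⇒ TL `m_s²` ceiling `(1 − 2 dlo)/4`** (the floor on every even torus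
`L ≥ L₀` is what ONE docc window certificate gives, `groundState_re_expect_ge_of_window_certificate_d4_ineq`);
the only unconditional TL statement about `S(π,π)/N` in M2. [cite: Tasaki2020, App. A.3] -/
theorem StagMagSqTLCeilingRow.of_torusDoccFloor {U : ℝ} {dlo : ℚ} {L₀ : ℕ}
    (h : ∀ (L : ℕ) [NeZero L], L₀ ≤ L → Even L → ∀ ψ : Fock (Orb (FermionTorus 2 L)),
      IsGroundState (hamiltonian (fermionTorusGraph 2 L) 1 U) (L ^ 2) ψ → star ψ ⬝ᵥ ψ = 1 →
        ((dlo : ℚ) : ℝ) ≤ doccDensity L ψ) :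
    StagMagSqTLCeilingRow U ((1 - 2 * dlo) / 4) := by
  intro ε hε
  obtain ⟨n, hn⟩ := exists_nat_gt (|1 - 2 * ((dlo : ℚ) : ℝ)| / ε)
  refine ⟨max L₀ (n + 1), fun L _ hL hLe ψ hψ hψ1 => ?_⟩
  have hL₀ : L₀ ≤ L := le_trans (le_max_left _ _) hL
  have hLn : n + 1 ≤ L := le_trans (le_max_right _ _) hL
  have hd := h L hL₀ hLe ψ hψ hψ1
  have hnL : (n : ℝ) + 1 ≤ (L : ℝ) := by exact_mod_cast hLn
  have hL1 : (1 : ℝ) ≤ (L : ℝ) := by linarith [(Nat.cast_nonneg n : (0 : ℝ) ≤ n)]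
  have hL0 : (0 : ℝ) < (L : ℝ) := by linarith
  have h1 := stagMagSq_le hLe hψ.1 hψ1
  have hA : (1 / 4 + 1 / (L : ℝ) ^ 2) * (1 - 2 * doccDensity L ψ) ≤
      (1 / 4 + 1 / (L : ℝ) ^ 2) * (1 - 2 * ((dlo : ℚ) : ℝ)) := by
    have hc : (0 : ℝ) ≤ 1 / 4 + 1 / (L : ℝ) ^ 2 := by positivity
    exact mul_le_mul_of_nonneg_left (by linarith) hc
  have key1 : (1 - 2 * ((dlo : ℚ) : ℝ)) / (L : ℝ) ^ 2 ≤ |1 - 2 * ((dlo : ℚ) : ℝ)| / (L : ℝ) := by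
    have hsq : (L : ℝ) ≤ (L : ℝ) ^ 2 := by nlinarith
    calc (1 - 2 * ((dlo : ℚ) : ℝ)) / (L : ℝ) ^ 2 ≤ |1 - 2 * ((dlo : ℚ) : ℝ)| / (L : ℝ) ^ 2 :=
          div_le_div_of_nonneg_right (le_abs_self _) (by positivity)
      _ ≤ |1 - 2 * ((dlo : ℚ) : ℝ)| / (L : ℝ) := div_le_div_of_nonneg_left (abs_nonneg _) hL0 hsq
  have key2 : |1 - 2 * ((dlo : ℚ) : ℝ)| / (L : ℝ) ≤ ε := by
    rw [div_le_iff₀ hL0]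
    have hn' := (div_lt_iff₀ hε).1 hn
    nlinarith [hn', hnL, hε.le, abs_nonneg (1 - 2 * ((dlo : ℚ) : ℝ))]
  have hfin : stagMagSq L ψ ≤ (1 - 2 * ((dlo : ℚ) : ℝ)) / 4 + ε :=
    calc stagMagSq L ψ ≤ (1 / 4 + 1 / (L : ℝ) ^ 2) * (1 - 2 * doccDensity L ψ) := h1
      _ ≤ (1 / 4 + 1 / (L : ℝ) ^ 2) * (1 - 2 * ((dlo : ℚ) : ℝ)) := hA
      _ = (1 - 2 * ((dlo : ℚ) : ℝ)) / 4 + (1 - 2 * ((dlo : ℚ) : ℝ)) / (L : ℝ) ^ 2 := by ring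
      _ ≤ (1 - 2 * ((dlo : ℚ) : ℝ)) / 4 + ε := by linarith [key1, key2]
  push_cast
  exact hfin

end M2

end Summit.Ventures.CertifiedManyBodySolver

end
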